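import Summits.NavierStokesRegularity.NavierStokesRegularity.Theorems.LocalSineTubeDoorLocalPointZoomZoom
import Literature.Analysis.FluidPDE.SereginSverak2002BlowupLargeness
import Literature.Analysis.FluidPDE.SereginSverakBlowupSelection
import Literature.Analysis.FluidPDE.LocalTypeIReverseTools
import HarnessLib

/-!
# Crux `TerminalTrace.TraceDensityCriterion` (stmt-NavierStokesRegularity-18614), LOCAL Type-I cell — tool:
# the Morrey bound AT THE VERTEX of a locally Type-I point

Seat nsreg-C26-p1 g6 (cell ns-regularity-ideate), `--supports stmt-NavierStokesRegularity-18614 --as helper` (tool for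
the local form of the Type-I cell; closes nothing).  The door routes of the cell (`HalfSpaceWindowDoor`, `UnthreadedDoor`,
…) carry the LOCAL Type-I hypothesis `‖u(t,x)‖ √(ν(T−t)) ≤ M` on `(T − ρ², T) × B(x₀, ρ)`; the landed Type-I cell of the
crux (`TerminalTrace.typeI_traceDensityCriterion`, p652624) used the GLOBAL rate `IsTypeIBlowup u T` through the Morrey
bound `morrey_of_typeI`.  For the local version the one place where a Morrey bound of `u` itself (not of its zoom) is
needed is the pairing modulus at the vertex (`TypeITraceScarL3.zoom_pairing_modulus_of_morrey`: a bound
`∫_{B(x₀,ρ')} ‖u(t)‖² ≤ M₀ ρ'` for `ρ' ≤ r₀` and ALL `t` of a fixed final window).  This file supplies it from the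
local rate and the finite Albritton–Barker quantity of the vertex zoom
(`LocalSineTubeDoorLocalPointZoomZoom.exists_zoom_typeIBound_lt_top_of_localTypeI`):

* `TraceDensityCriterion.continuousOn_setIntegral_ball_norm_sq_Ioo` — continuity in time of the local energy of a
  field jointly continuous on `(a, b) × ℝ³` (dominated convergence);
* `TraceDensityCriterion.morrey_at_vertex_of_zoom_typeIBound` (`ν = 1`) — if `𝐈(Q(1/2))` of the vertex zoom
  `v = R u(T + R²·, x₀ + R·)` is finite (`R ≤ ρ`, `R² ≤ T`) and the local rate holds on `(T − ρ², T) × B(x₀, ρ)`, then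
  `∫_{B(x₀,ρ')} ‖u(t)‖² ≤ M₀ ρ'` for `0 < ρ' ≤ R/2`, `T − R²/4 < t < T`: for `T − t < ρ'²` by the scaled-energy part
  `A` of `𝐈` at the vertex sub-cylinder `Q_{ρ'/R}(0)` (essential supremum upgraded to every time by continuity, then
  un-zoomed by `SereginSverak2002.setIntegral_ball_norm_sq_stZoom`), for `T − t ≥ ρ'²` by the rate
  (`‖u‖ ≤ M/ρ'` on the ball).

WHAT THIS IS NOT: not NS regularity, not the crux; bookkeeping for HYPOTHETICAL locally Type-I blow-ups.
[cite: AlbrittonBarker2019, Lemma 2.5] [folklore]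
-/

noncomputable section

set_option linter.dupNamespace false

namespace Summit.NavierStokesRegularity.NavierStokesRegularity.Theorems.TraceDensityCriterion

open MeasureTheory Set Function Filter Topology TopologicalSpace Metric
open Literature.Analysis.FluidPDE
open scoped NNReal ENNReal

/-- **Continuity in time of the local energy** of a field jointly continuous on `(a, b) × ℝ³`:
`t ↦ ∫_{B(x₁,r)} ‖g t x‖²` is continuous on `(a, b)` (dominated convergence with the bound from compactness of
`[t₁ − ε, t₁ + ε] × B̄(x₁, |r|)`). [folklore] -/
theorem continuousOn_setIntegral_ball_norm_sq_Ioo {g : ℝ → EuclideanSpace ℝ (Fin 3) → EuclideanSpace ℝ (Fin 3)}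
    {a b : ℝ} (hg : ContinuousOn (uncurry g) (Ioo a b ×ˢ univ)) (x₁ : EuclideanSpace ℝ (Fin 3)) (r : ℝ) :
    ContinuousOn (fun t => ∫ x in ball x₁ r, ‖g t x‖ ^ 2) (Ioo a b) := by
  -- adapted from Theorems/SqueezeCycleExtremalElementExistsEnergy.lean
  -- (`continuousOn_setIntegral_ball_norm_sq_of_continuousOn`), specialised to an open interval
  intro t₁ ht₁
  obtain ⟨ε, hε, hεS⟩ := Metric.isOpen_iff.1 isOpen_Ioo t₁ ht₁
  have hIcc : Icc (t₁ - ε / 2) (t₁ + ε / 2) ⊆ Ioo a b := fun t ht =>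
    hεS (by rw [mem_ball, Real.dist_eq, abs_lt]; constructor <;> linarith [ht.1, ht.2])
  have hK : IsCompact (Icc (t₁ - ε / 2) (t₁ + ε / 2) ×ˢ closedBall x₁ |r|) :=
    isCompact_Icc.prod (isCompact_closedBall _ _)
  obtain ⟨M, hM⟩ := hK.exists_bound_of_continuousOn (hg.mono (prod_mono hIcc (subset_univ _)))
  have hnhds : Ioo (t₁ - ε / 2) (t₁ + ε / 2) ∈ 𝓝[Ioo a b] t₁ :=
    mem_nhdsWithin_of_mem_nhds (Ioo_mem_nhds (by linarith) (by linarith))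
  refine ContinuousWithinAt.mono_of_mem_nhdsWithin ?_ hnhds
  have hslice : ∀ t ∈ Ioo a b, Continuous (g t) := fun t ht =>
    hg.comp_continuous (continuous_const.prodMk continuous_id) fun x => ⟨ht, mem_univ x⟩
  have key : ContinuousOn (fun t => ∫ x in ball x₁ r, ‖g t x‖ ^ 2) (Ioo (t₁ - ε / 2) (t₁ + ε / 2)) := by
    refine continuousOn_of_dominated (bound := fun _ => M ^ 2) (fun t ht => ?_) (fun t ht => ?_) ?_ ?_
    · exact (((hslice t (hIcc (Ioo_subset_Icc_self ht))).norm.pow 2)).aestronglyMeasurable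
    · refine (ae_restrict_mem measurableSet_ball).mono fun x hx => ?_
      rw [Real.norm_eq_abs, abs_of_nonneg (sq_nonneg _)]
      have hxK : (t, x) ∈ Icc (t₁ - ε / 2) (t₁ + ε / 2) ×ˢ closedBall x₁ |r| :=
        ⟨Ioo_subset_Icc_self ht, mem_closedBall.2 ((mem_ball.1 hx).le.trans (le_abs_self r))⟩
      have h := hM (t, x) hxK
      exact pow_le_pow_left₀ (norm_nonneg _) h 2
    · exact integrableOn_const (measure_ball_lt_top.ne) |>.integrable
    · refine (ae_restrict_mem measurableSet_ball).mono fun x _ => ?_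
      have hcx : ContinuousOn (fun t => g t x) (Ioo a b) :=
        hg.comp (continuousOn_id.prodMk continuousOn_const) fun t' ht' => ⟨ht', mem_univ x⟩
      exact ((hcx.mono (Ioo_subset_Icc_self.trans hIcc)).norm.pow 2)
  exact key t₁ ⟨by linarith, by linarith⟩

/-- **The Morrey bound at the vertex of a locally Type-I point, `ν = 1`.**  `(u, p)` classical on `[0, T) × ℝ³`
(`ν = 1`), local rate `‖u(t,x)‖ √(T − t) ≤ M` on `(T − ρ², T) × B(x₀, ρ)`, and a vertex zoom scale `0 < R ≤ ρ`,
`R² ≤ T`, at which the Albritton–Barker quantity of `v = R u(T + R²·, x₀ + R·)` on `Q(1/2)` is finite (any pressure /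
gradient arguments).  Then `∫_{B(x₀,ρ')} ‖u(t)‖² ≤ M₀ ρ'` for all `0 < ρ' ≤ R/2` and `T − R²/4 < t < T`.
[cite: AlbrittonBarker2019, Lemma 2.5] [folklore] -/
theorem morrey_at_vertex_of_zoom_typeIBound {T : ℝ} (hT : 0 < T)
    {u : ℝ → EuclideanSpace ℝ (Fin 3) → EuclideanSpace ℝ (Fin 3)} {p : ℝ → EuclideanSpace ℝ (Fin 3) → ℝ}
    (hsol : IsClassicalNSSolutionOn (Ico 0 T) 1 0 u p)
    {x₀ : EuclideanSpace ℝ (Fin 3)} {ρ M : ℝ}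
    (hM : ∀ t ∈ Ico 0 T, T - ρ ^ 2 < t → ∀ x ∈ ball x₀ ρ, ‖u t x‖ * Real.sqrt (1 * (T - t)) ≤ M)
    {R : ℝ} (hR : 0 < R) (hRρ : R ≤ ρ) (hRT : R ^ 2 ≤ T)
    {πv : ℝ → EuclideanSpace ℝ (Fin 3) → ℝ}
    {Gv : ℝ → EuclideanSpace ℝ (Fin 3) → EuclideanSpace ℝ (Fin 3) →L[ℝ] EuclideanSpace ℝ (Fin 3)}
    (htypeI : typeIBound (parabolicCylinder (1 / 2) (0 : ℝ × EuclideanSpace ℝ (Fin 3)))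
      (R • stPull (R ^ 2) R T x₀ u) πv Gv < ⊤) :
    ∃ r₀ M₀ T₁ : ℝ, 0 < r₀ ∧ T₁ < T ∧
      ∀ t ∈ Ioo T₁ T, ∀ ρ' : ℝ, 0 < ρ' → ρ' ≤ r₀ → ∫ x in ball x₀ ρ', ‖u t x‖ ^ 2 ≤ M₀ * ρ' := by
  set v : ℝ → EuclideanSpace ℝ (Fin 3) → EuclideanSpace ℝ (Fin 3) := R • stPull (R ^ 2) R T x₀ u with hv
  set I₀ : ℝ≥0∞ := typeIBound (parabolicCylinder (1 / 2) (0 : ℝ × EuclideanSpace ℝ (Fin 3))) v πv Gv with hI₀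
  have hI₀top : I₀ ≠ ⊤ := htypeI.ne
  set I : ℝ := I₀.toReal with hI
  have hI0 : 0 ≤ I := ENNReal.toReal_nonneg
  set M' : ℝ := max M 0 with hM'
  have hM'0 : 0 ≤ M' := le_max_right _ _
  set V₁ : ℝ := volume.real (ball (0 : EuclideanSpace ℝ (Fin 3)) 1) with hV₁
  have hV₁0 : 0 ≤ V₁ := measureReal_nonneg
  -- joint continuity of `u` below `T`
  have hcontu : ContinuousOn (uncurry u) (Ico 0 T ×ˢ (univ : Set (EuclideanSpace ℝ (Fin 3)))) :=
    hsol.smooth_velocity.continuousOn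
  refine ⟨R / 2, max I (M' ^ 2 * V₁), T - R ^ 2 / 4, by positivity, by nlinarith, ?_⟩
  intro t ht ρ' hρ' hρ'R
  have hR2 : 0 < R ^ 2 := by positivity
  have ht0 : 0 ≤ t := by nlinarith [ht.1]
  have htT : t < T := ht.2
  by_cases hcase : T - t < ρ' ^ 2
  · -- ## Case A: `T − t < ρ'²` — the scaled energy `A` of the zoom at the vertex sub-cylinder `Q_r(0)`, `r = ρ'/R`
    set r : ℝ := ρ' / R with hr
    have hr0 : 0 < r := by positivity
    have hrhalf : r ≤ 1 / 2 := by rw [hr, div_le_iff₀ hR]; linarith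
    have hRr : R * r = ρ' := by rw [hr]; field_simp
    -- `A_ess(r; 0)[v] ≤ I₀`
    have hA : cknAEss r (0 : ℝ × EuclideanSpace ℝ (Fin 3)) v ≤ I₀ := by
      refine le_trans ?_ (abScaledSum_le_typeIBound (u := v) (p := πv) (G := Gv) hr0
        (SuitableCompactness.parabolicCylinder_zero_mono hr0.le hrhalf))
      exact le_add_right (le_add_right le_self_add)
    -- a.e. in zoomed time
    have hae : ∀ᵐ s ∂(volume.restrict (Ioo (-r ^ 2) 0)),
        (ENNReal.ofReal r)⁻¹ * ∫⁻ y in ball (0 : EuclideanSpace ℝ (Fin 3)) r, ‖v s y‖ₑ ^ 2 ≤ I₀ := by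
      have hA' : essSup (fun s : ℝ => (ENNReal.ofReal r)⁻¹ *
          ∫⁻ y in ball (0 : EuclideanSpace ℝ (Fin 3)) r, ‖v s y‖ₑ ^ 2) (volume.restrict (Ioo (-r ^ 2) 0)) ≤ I₀ := by
        have h := hA
        unfold cknAEss at h
        simpa using h
      filter_upwards [ENNReal.ae_le_essSup (μ := volume.restrict (Ioo (-r ^ 2) 0))
        (fun s : ℝ => (ENNReal.ofReal r)⁻¹ * ∫⁻ y in ball (0 : EuclideanSpace ℝ (Fin 3)) r, ‖v s y‖ₑ ^ 2)]
        with s hs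
      exact hs.trans hA'
    -- the real local energy of the zoom and its continuity on `(-r², 0)`
    set F : ℝ → ℝ := fun s => ∫ y in ball (0 : EuclideanSpace ℝ (Fin 3)) r, ‖v s y‖ ^ 2 with hF
    have hmaps : MapsTo (fun z : ℝ × EuclideanSpace ℝ (Fin 3) => (T + R ^ 2 * z.1, x₀ + R • z.2))
        (Ioo (-r ^ 2) 0 ×ˢ (univ : Set (EuclideanSpace ℝ (Fin 3))))
        (Ico 0 T ×ˢ (univ : Set (EuclideanSpace ℝ (Fin 3)))) := by
      intro z hz
      obtain ⟨⟨hz1, hz2⟩, -⟩ := hz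
      have hr2 : r ^ 2 ≤ 1 / 4 := by nlinarith
      have h1 : -(R ^ 2 * r ^ 2) < R ^ 2 * z.1 := by nlinarith [mul_lt_mul_of_pos_left hz1 hR2]
      have h2 : R ^ 2 * r ^ 2 ≤ T / 4 := by nlinarith [mul_le_mul_of_nonneg_left hr2 hR2.le]
      have h3 : R ^ 2 * z.1 < 0 := mul_neg_of_pos_of_neg hR2 hz2
      refine ⟨⟨?_, ?_⟩, mem_univ _⟩
      · show 0 ≤ T + R ^ 2 * z.1
        linarith
      · show T + R ^ 2 * z.1 < T
        linarith
    have hcontv : ContinuousOn (uncurry v) (Ioo (-r ^ 2) 0 ×ˢ (univ : Set (EuclideanSpace ℝ (Fin 3)))) := by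
      have haff : Continuous fun z : ℝ × EuclideanSpace ℝ (Fin 3) => (T + R ^ 2 * z.1, x₀ + R • z.2) := by
        fun_prop
      have h := (hcontu.comp haff.continuousOn hmaps).const_smul R
      refine h.congr fun z _ => ?_
      simp only [uncurry, hv, smul_stPull_apply, Function.comp_apply, Pi.smul_apply]
    have hcontF : ContinuousOn F (Ioo (-r ^ 2) 0) := continuousOn_setIntegral_ball_norm_sq_Ioo hcontv 0 r
    -- the a.e. bound in real form: `F s ≤ I r`
    have haeF : ∀ᵐ s ∂(volume.restrict (Ioo (-r ^ 2) 0)), F s ≤ I * r := by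
      filter_upwards [hae, ae_restrict_mem measurableSet_Ioo] with s hs hsI
      have hslice : Continuous (v s) :=
        hcontv.comp_continuous (continuous_const.prodMk continuous_id) fun y => ⟨hsI, mem_univ y⟩
      have hint : IntegrableOn (fun y => ‖v s y‖ ^ 2) (ball (0 : EuclideanSpace ℝ (Fin 3)) r) :=
        ((hslice.norm.pow 2).continuousOn.integrableOn_compact
          (isCompact_closedBall (0 : EuclideanSpace ℝ (Fin 3)) r)).mono_set ball_subset_closedBall
      have e : ∫⁻ y in ball (0 : EuclideanSpace ℝ (Fin 3)) r, ‖v s y‖ₑ ^ 2 = ENNReal.ofReal (F s) := by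
        rw [hF]
        simp only
        rw [ofReal_integral_eq_lintegral_ofReal hint (Eventually.of_forall fun y => sq_nonneg _)]
        refine lintegral_congr fun y => ?_
        rw [← ofReal_norm, ENNReal.ofReal_pow (norm_nonneg _)]
      rw [e] at hs
      have hr0' : ENNReal.ofReal r ≠ 0 := by rwa [ne_eq, ENNReal.ofReal_eq_zero, not_le]
      have h1 : ENNReal.ofReal (F s) ≤ I₀ * ENNReal.ofReal r := by
        calc ENNReal.ofReal (F s) = ENNReal.ofReal r * ((ENNReal.ofReal r)⁻¹ * ENNReal.ofReal (F s)) := by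
              rw [← mul_assoc, ENNReal.mul_inv_cancel hr0' ENNReal.ofReal_ne_top, one_mul]
          _ ≤ ENNReal.ofReal r * I₀ := by gcongr
          _ = I₀ * ENNReal.ofReal r := mul_comm _ _
      have h2 := (ENNReal.ofReal_le_iff_le_toReal (ENNReal.mul_ne_top hI₀top ENNReal.ofReal_ne_top)).1 h1
      rwa [ENNReal.toReal_mul, ENNReal.toReal_ofReal hr0.le] at h2
    -- everywhere on `(-r², 0)` by continuity
    have hallF := SereginSverak2009.forall_le_of_ae_le_of_continuousOn (μ := volume) isOpen_Ioo hcontF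
      continuousOn_const haeF
    -- the zoomed time of `t`
    set s : ℝ := (t - T) / R ^ 2 with hs
    have hts : T + R ^ 2 * s = t := by rw [hs]; field_simp; ring
    have hsI : s ∈ Ioo (-r ^ 2) 0 := by
      constructor
      · rw [hs, lt_div_iff₀ hR2]
        have : r ^ 2 * R ^ 2 = ρ' ^ 2 := by rw [hr, div_pow]; field_simp
        nlinarith
      · rw [hs]; exact div_neg_of_neg_of_pos (by linarith) hR2
    have hFs := hallF s hsI
    -- un-zoom: `F s = R⁻¹ ∫_{B(x₀, ρ')} ‖u t‖²`
    have hunzoom : F s = R⁻¹ * ∫ x in ball x₀ ρ', ‖u t x‖ ^ 2 := by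
      have h := SereginSverak2002.setIntegral_ball_norm_sq_stZoom hR T s x₀ 0 r u
      rw [smul_zero, add_zero, hRr, hts] at h
      rw [hF]
      exact h
    rw [hunzoom] at hFs
    have key : ∫ x in ball x₀ ρ', ‖u t x‖ ^ 2 ≤ I * ρ' := by
      have h1 : R * (R⁻¹ * ∫ x in ball x₀ ρ', ‖u t x‖ ^ 2) ≤ R * (I * r) :=
        mul_le_mul_of_nonneg_left hFs hR.le
      rw [← mul_assoc, mul_inv_cancel₀ hR.ne', one_mul] at h1
      calc ∫ x in ball x₀ ρ', ‖u t x‖ ^ 2 ≤ R * (I * r) := h1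
        _ = I * ρ' := by rw [← hRr]; ring
    exact key.trans (mul_le_mul_of_nonneg_right (le_max_left _ _) hρ'.le)
  · -- ## Case B: `T − t ≥ ρ'²` — the local rate gives `‖u(t)‖ ≤ M'/ρ'` on `B(x₀, ρ')`
    rw [not_lt] at hcase
    have htI : t ∈ Ico 0 T := ⟨ht0, htT⟩
    have htρ : T - ρ ^ 2 < t := by
      have : R ^ 2 ≤ ρ ^ 2 := pow_le_pow_left₀ hR.le hRρ 2
      nlinarith [ht.1]
    have hsqrt : ρ' ≤ Real.sqrt (1 * (T - t)) := by
      rw [one_mul]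
      exact Real.le_sqrt_of_sq_le hcase
    have hpt : ∀ x ∈ ball x₀ ρ', ‖u t x‖ ^ 2 ≤ (M' / ρ') ^ 2 := by
      intro x hx
      have hxρ : x ∈ ball x₀ ρ := ball_subset_ball (by linarith) hx
      have hb := (hM t htI htρ x hxρ).trans (le_max_left M 0)
      have h1 : ‖u t x‖ * ρ' ≤ M' :=
        le_trans (mul_le_mul_of_nonneg_left hsqrt (norm_nonneg _)) hb
      have h2 : ‖u t x‖ ≤ M' / ρ' := by rwa [le_div_iff₀ hρ']
      exact pow_le_pow_left₀ (norm_nonneg _) h2 2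
    have hvol : volume.real (ball x₀ ρ') = ρ' ^ 3 * V₁ := by
      rw [hV₁, measureReal_def, measureReal_def, Measure.addHaar_ball volume x₀ hρ'.le,
        finrank_euclideanSpace_fin, ENNReal.toReal_mul, ENNReal.toReal_ofReal (pow_nonneg hρ'.le 3)]
    have hint := setIntegral_mono_on (μ := volume) (s := ball x₀ ρ')
      (f := fun x => ‖u t x‖ ^ 2) (g := fun _ => (M' / ρ') ^ 2) ?_ ?_ measurableSet_ball hpt
    · rw [setIntegral_const, hvol, smul_eq_mul] at hint
      calc ∫ x in ball x₀ ρ', ‖u t x‖ ^ 2 ≤ ρ' ^ 3 * V₁ * (M' / ρ') ^ 2 := hint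
        _ = M' ^ 2 * V₁ * ρ' := by field_simp
        _ ≤ max I (M' ^ 2 * V₁) * ρ' := mul_le_mul_of_nonneg_right (le_max_right _ _) hρ'.le
    · exact (((hsol.contDiff_velocity htI).continuous.norm.pow 2).continuousOn.integrableOn_compact
        (isCompact_closedBall x₀ ρ')).mono_set ball_subset_closedBall
    · exact integrableOn_const (measure_ball_lt_top.ne)

end Summit.NavierStokesRegularity.NavierStokesRegularity.Theorems.TraceDensityCriterion

end
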